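import Mathlib
import HarnessLib
import Summits.NavierStokesRegularity.NavierStokesRegularity.Theorems.HalfSpaceWindowDoorCirculationCarryingRigidityEddyMeans
import Summits.NavierStokesRegularity.NavierStokesRegularity.Theorems.HalfSpaceWindowDoorCirculationCarryingRigidityFlatTools
import Summits.NavierStokesRegularity.NavierStokesRegularity.Theorems.HalfSpaceWindowDoorCirculationCarryingRigidityQuietTools

/-!
# Route `HalfSpaceWindowDoor`, crux `CirculationCarryingRigidity` (stmt-NavierStokesRegularity-25311) — line `eddy_covariance`:
# the circle integrals at a touching point of the MIXED (linear + quadratic) barrier, and the scale-invariant «quiet» bounds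

LEAD ns-hsw-p1 g10, `--supports 25311 --as helper`; card `Cruxes/…/Lines/eddy_covariance.md`.  As `…FlatTouching.circ_integrals_of_touching`,
for the comparison `q = (2π)⁻¹Γ(|x_h|,x₂,t) − (2π)⁻¹(μ + κ|x_h|² + ℓ|x_h|)` with a LINEAR term: if `∇q(x) = ε·E·2x` off the axis then
`∮ω₃ dl = (4πεE + 2κ)|x_h| + ℓ` and `∮ω_r dl = −4πεE x₂` (`circ_integrals_of_touching_lin`).  With the sweeping choices
`κ = θ/(√(−t)√(−s₀))`, `ℓ = 2πC·((−t)(−s₀))^{−1/4}`, `|x_h| ≥ R₁√(−t)`, `R₁ ≥ 8πC/η₀`, `θ = η₀/8` and `ε ≤ ε₀(η₀, s₀, …)` this gives the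
SCALE-INVARIANT quietness `(−t)∮ω₃ dl ≤ η₀|x_h|`, `(−t)|∮ω_r dl| ≤ η₀|x_h|` (`quiet_r_bound`, `quiet_z_bound`; pure real arithmetic).
WHAT THIS IS NOT: not about NS regularity; kinematics/bookkeeping for HYPOTHETICAL blow-up profiles.  No item is closed by this file.
-/

noncomputable section

-- the summit and its single sub-problem share the name (CONVENTIONS §1), as in every Theorems file
set_option linter.dupNamespace false

namespace Summit.NavierStokesRegularity.NavierStokesRegularity.Theorems.HalfSpaceWindowDoorCirculationCarryingRigidityQuietTouching

open MeasureTheory Set Function Filter Topology InnerProductSpace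
open scoped RealInnerProductSpace InnerProductSpace Laplacian
open Literature.Analysis Literature.Analysis.UnboundedOperators
open Literature.Analysis.FluidPDE hiding eR
open Summit.NavierStokesRegularity.NavierStokesRegularity.Theorems.HalfSpaceWindowDoorCirculationCarryingRigidityDefs
  (InDoorClass SignE3 e3)
open Summit.NavierStokesRegularity.NavierStokesRegularity.Theorems.AxisTwistDoorAveragedConeLiouvilleDefs
  (cylPt eT eR circ vortCirc radVortCirc tiltCirc circleTerm meanR meanZ remainder)
open Summit.NavierStokesRegularity.NavierStokesRegularity.Theorems.AveragedConeLiouville.CircleStokes (continuous_eR)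
open Summit.NavierStokesRegularity.NavierStokesRegularity.Theorems.AxisTwistDoorAveragedConeLiouvilleCylFrame
  (continuous_cylPt_θ abs_inner_eR_le abs_inner_e3_le abs_integral_le_const_mul_add norm_eR)
open Summit.NavierStokesRegularity.NavierStokesRegularity.Theorems.AveragedConeLiouville.CircleStokes
  (deriv_circ_eq_vortCirc)
open Summit.NavierStokesRegularity.NavierStokesRegularity.Theorems.AveragedConeLiouville.CircleCalculus (deriv_circ_z)
open Summit.NavierStokesRegularity.NavierStokesRegularity.Theorems.AveragedConeLiouville.CircMonotone
  (circ_zero circ_mono circ_nonneg vortCirc_nonneg)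
open Summit.NavierStokesRegularity.NavierStokesRegularity.Theorems.HalfSpaceWindowDoorCirculationCarryingRigidityAxisCirculation
  (contDiff_circF isSmoothSpaceTimeOn_circF isSmoothSpaceTimeOn_of_class fderiv_circF_eR laplacian_circF hasDerivAt_circF_time
    contDiffOn_circ)
open Summit.NavierStokesRegularity.NavierStokesRegularity.Theorems.AxisTwistDoorAveragedConeLiouvilleAxisLift
  (lift gradient_lift contDiffAt_lift)

open Summit.NavierStokesRegularity.NavierStokesRegularity.Theorems.HalfSpaceWindowDoorCirculationCarryingRigidityConeFluxSubsolution


open Summit.NavierStokesRegularity.NavierStokesRegularity.Theorems.HalfSpaceWindowDoorCirculationCarryingRigidityEddyMeans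
  (fderiv_circF_eZ)
open Summit.NavierStokesRegularity.NavierStokesRegularity.Theorems.HalfSpaceWindowDoorCirculationCarryingRigidityFlatTools
  (inner_self_eR)
open Summit.NavierStokesRegularity.NavierStokesRegularity.Theorems.HalfSpaceWindowDoorCirculationCarryingRigidityQuietTools
  (fderiv_const_mul_cylRadius contDiffAt_const_mul_cylRadius)

variable {C : ℝ} {v : ℝ → EuclideanSpace ℝ (Fin 3) → EuclideanSpace ℝ (Fin 3)}

set_option maxHeartbeats 400000 in
/-- **The circle integrals at a touching point.**  For a door-class profile, `t < 0`, an off-axis point `x`, and reals `μ, κ, ε, E`: if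
`∇[(2π)⁻¹Γ(|·_h|,·₂,t) − (2π)⁻¹(μ + κ(y₀²+y₁²))](x) = ε·(E·2⟪x,·⟫)`, then `∮_{S(|x_h|,x₂)}ω₃ dl = (4πεE + 2κ)|x_h|` and
`∮_{S(|x_h|,x₂)}ω_r dl = −4πεE·x₂`. -/
theorem circ_integrals_of_touching_lin (hv : InDoorClass C v) {t : ℝ} (ht : t < 0) {x : EuclideanSpace ℝ (Fin 3)}
    (hx : cylRadius x ≠ 0) {μ κ ℓ ε E : ℝ}
    (hgrad : fderiv ℝ (fun y : EuclideanSpace ℝ (Fin 3) =>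
        (2 * Real.pi)⁻¹ * circ v (cylRadius y) (y 2) t - (2 * Real.pi)⁻¹ * (μ + κ * (y 0 * y 0 + y 1 * y 1) + ℓ * cylRadius y)) x =
      ε • (E • ((2 : ℝ) • innerSL ℝ x))) :
    vortCirc v (cylRadius x) (x 2) t = (4 * Real.pi * ε * E + 2 * κ) * cylRadius x + ℓ ∧
      radVortCirc v (cylRadius x) (x 2) t = -(4 * Real.pi * ε * E * x 2) := by
  have hsm := isSmoothSpaceTimeOn_of_class hv.1 hv.2.1 hv.2.2.1 hv.2.2.2
  have h2π : 0 < 2 * Real.pi := by positivity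
  set ρ := cylRadius x with hρ
  have hρ2 : ρ ^ 2 = x 0 * x 0 + x 1 * x 1 := by rw [cylRadius_sq x]; ring
  set F : EuclideanSpace ℝ (Fin 3) → ℝ := fun y => (2 * Real.pi)⁻¹ * circ v (cylRadius y) (y 2) t with hF
  set φ : EuclideanSpace ℝ (Fin 3) → ℝ := fun y => (2 * Real.pi)⁻¹ * (μ + κ * (y 0 * y 0 + y 1 * y 1) + ℓ * cylRadius y) with hφ
  have hF2 : ContDiff ℝ 2 F := contDiff_circF ((hsm.contDiff_slice ht).of_le (by norm_cast))
  have hproj : ∀ (i : Fin 3) (w : EuclideanSpace ℝ (Fin 3)), EuclideanSpace.proj (𝕜 := ℝ) i w = w i := fun i w => rfl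
  have hQ := HalfSpaceWindowDoorCirculationCarryingRigidityConeFluxSubsolution.hasFDerivAt_horizSq x
  have hL := (Literature.Analysis.FluidPDE.hasFDerivAt_cylRadius hx).const_mul ℓ
  have hφ_has : HasFDerivAt φ
      ((2 * Real.pi)⁻¹ • (κ • ((x 0 • EuclideanSpace.proj (𝕜 := ℝ) (0 : Fin 3) + x 0 • EuclideanSpace.proj (𝕜 := ℝ) (0 : Fin 3)) +
        (x 1 • EuclideanSpace.proj (𝕜 := ℝ) (1 : Fin 3) + x 1 • EuclideanSpace.proj (𝕜 := ℝ) (1 : Fin 3))) +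
        ℓ • innerSL ℝ (Literature.Analysis.FluidPDE.eR x))) x :=
    (((hQ.const_mul κ).const_add μ).add hL).const_mul ((2 * Real.pi)⁻¹)
  have heR0 : (Literature.Analysis.FluidPDE.eR x) 0 = ρ⁻¹ * x 0 := by simp [Literature.Analysis.FluidPDE.eR, hρ]
  have heR1 : (Literature.Analysis.FluidPDE.eR x) 1 = ρ⁻¹ * x 1 := by simp [Literature.Analysis.FluidPDE.eR, hρ]
  have heZ0 : (eZ : EuclideanSpace ℝ (Fin 3)) 0 = 0 := by simp [eZ]
  have heZ1 : (eZ : EuclideanSpace ℝ (Fin 3)) 1 = 0 := by simp [eZ]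
  have hφ_dir : ∀ a' c' : ℝ, fderiv ℝ φ x (a' • Literature.Analysis.FluidPDE.eR x + c' • (eZ : EuclideanSpace ℝ (Fin 3))) =
      (2 * Real.pi)⁻¹ * (κ * (a' * (2 * ρ)) + ℓ * a') := by
    intro a' c'
    have hinn : ⟪Literature.Analysis.FluidPDE.eR x, a' • Literature.Analysis.FluidPDE.eR x + c' • (eZ : EuclideanSpace ℝ (Fin 3))⟫_ℝ = a' := by
      rw [inner_add_right, real_inner_smul_right, real_inner_smul_right, Literature.Analysis.FluidPDE.inner_eR_self hx,
        Literature.Analysis.FluidPDE.inner_eR_eZ, mul_one, mul_zero, add_zero]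
    have hw0 : (a' • Literature.Analysis.FluidPDE.eR x + c' • (eZ : EuclideanSpace ℝ (Fin 3))) 0 = a' * (ρ⁻¹ * x 0) := by
      rw [PiLp.add_apply, PiLp.smul_apply, PiLp.smul_apply, smul_eq_mul, smul_eq_mul, heR0, heZ0, mul_zero, add_zero]
    have hw1 : (a' • Literature.Analysis.FluidPDE.eR x + c' • (eZ : EuclideanSpace ℝ (Fin 3))) 1 = a' * (ρ⁻¹ * x 1) := by
      rw [PiLp.add_apply, PiLp.smul_apply, PiLp.smul_apply, smul_eq_mul, smul_eq_mul, heR1, heZ1, mul_zero, add_zero]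
    rw [hφ_has.fderiv]
    simp only [smul_apply, add_apply, hproj, smul_eq_mul, hw0, hw1, innerSL_apply_apply, hinn]
    have e : x 0 * (a' * (ρ⁻¹ * x 0)) + x 0 * (a' * (ρ⁻¹ * x 0)) +
        (x 1 * (a' * (ρ⁻¹ * x 1)) + x 1 * (a' * (ρ⁻¹ * x 1))) =
        a' * (2 * (ρ⁻¹ * (x 0 * x 0 + x 1 * x 1))) := by ring
    rw [e, ← hρ2, pow_two, ← mul_assoc ρ⁻¹, inv_mul_cancel₀ hx, one_mul]
  -- `DF[w] = Dq[w] + Dφ[w]`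
  have hF_dir : ∀ w : EuclideanSpace ℝ (Fin 3), fderiv ℝ F x w = ε * (E * (2 * ⟪x, w⟫_ℝ)) + fderiv ℝ φ x w := by
    intro w
    have hq : (fun y => F y - φ y) = fun y : EuclideanSpace ℝ (Fin 3) =>
        (2 * Real.pi)⁻¹ * circ v (cylRadius y) (y 2) t - (2 * Real.pi)⁻¹ * (μ + κ * (y 0 * y 0 + y 1 * y 1) + ℓ * cylRadius y) := rfl
    have hFd : DifferentiableAt ℝ F x := (hF2.differentiable (by norm_num)).differentiableAt
    have e : F = fun y => (F y - φ y) + φ y := by funext y; ring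
    have hqd : DifferentiableAt ℝ (fun y => F y - φ y) x := hFd.sub hφ_has.differentiableAt
    rw [e, fderiv_fun_add hqd hφ_has.differentiableAt]
    show fderiv ℝ (fun y => F y - φ y) x w + fderiv ℝ φ x w = _
    rw [hq, hgrad]
    simp [smul_eq_mul]
  have hFr := fderiv_circF_eR hsm ht x
  have hFz := fderiv_circF_eZ hsm ht hx
  constructor
  · -- `(2π)⁻¹∮ω₃ dl = 2εEρ + (2π)⁻¹(2κρ + ℓ)`
    have h1 : (2 * Real.pi)⁻¹ * vortCirc v ρ (x 2) t = ε * (E * (2 * ρ)) + (2 * Real.pi)⁻¹ * (κ * (1 * (2 * ρ)) + ℓ * 1) := by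
      rw [← hFr, hF_dir, inner_self_eR, ← hρ, ← hφ_dir 1 0, one_smul, zero_smul, add_zero]
    have := congrArg (fun u => 2 * Real.pi * u) h1
    simp only at this
    rw [← mul_assoc, mul_inv_cancel₀ h2π.ne', one_mul] at this
    rw [this]; field_simp; ring
  · -- `−(2π)⁻¹∮ω_r dl = 2εE x₂`
    have heZin : ⟪x, (eZ : EuclideanSpace ℝ (Fin 3))⟫_ℝ = x 2 := by
      rw [real_inner_comm, eZ, EuclideanSpace.inner_single_left]; simp
    have hφZ : fderiv ℝ φ x (eZ : EuclideanSpace ℝ (Fin 3)) = 0 := by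
      have := hφ_dir 0 1
      rw [zero_smul, one_smul, zero_add] at this
      rw [this]; ring
    have h1 : -((2 * Real.pi)⁻¹ * radVortCirc v ρ (x 2) t) = ε * (E * (2 * x 2)) := by
      rw [← hFz, hF_dir, heZin, hφZ, add_zero]
    have := congrArg (fun u => -(2 * Real.pi) * u) h1
    simp only at this
    rw [neg_mul, mul_neg, neg_neg, ← mul_assoc, mul_inv_cancel₀ h2π.ne', one_mul] at this
    rw [this]; ring

/-! ### The scale-invariant quietness bounds at a touching point (pure real arithmetic) -/

/-- **Radial quietness**: `(−t)·((4πεE + 2κ)ρ + ℓ) ≤ η₀ ρ` when `κ = θ/(√(−t)√(−s₀))` with `θ = η₀/8`, `ℓ = 2πC·Q`,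
`Q = (√(−t)√(−s₀))^{−1/2}` with `Q√(−t) ≤ 1`, `ρ ≥ R₁√(−t)`, `8πC ≤ (η₀/4)·R₁`... precisely `2πC ≤ η₀/4 · R₁`, and
`4πεE(−t) ≤ η₀/4`. -/
theorem quiet_r_bound {η₀ t s₀ ε E θ ρ R₁ C' Q : ℝ} (ht : t < 0) (hts₀ : s₀ ≤ t) (hη₀ : 0 < η₀) (hρ0 : 0 ≤ ρ)
    (hθ : θ = η₀ / 8) (hεE : 4 * Real.pi * ε * E * (-t) ≤ η₀ / 4)
    (hC' : 0 ≤ C') (hQ : Q * Real.sqrt (-t) ≤ 1) (hR₁ : 2 * Real.pi * C' ≤ η₀ / 4 * R₁) (hρR : R₁ * Real.sqrt (-t) ≤ ρ) :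
    (-t) * ((4 * Real.pi * ε * E + 2 * (θ * (Real.sqrt (-t) * Real.sqrt (-s₀))⁻¹)) * ρ + 2 * Real.pi * C' * Q) ≤ η₀ * ρ := by
  have hs₀ : s₀ < 0 := lt_of_le_of_lt hts₀ ht
  have hsqt : 0 < Real.sqrt (-t) := Real.sqrt_pos.2 (neg_pos.2 ht)
  have hsq₀ : 0 < Real.sqrt (-s₀) := Real.sqrt_pos.2 (neg_pos.2 hs₀)
  have hst : Real.sqrt (-t) ≤ Real.sqrt (-s₀) := Real.sqrt_le_sqrt (by linarith)
  have htt : Real.sqrt (-t) * Real.sqrt (-t) = -t := Real.mul_self_sqrt (neg_pos.2 ht).le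
  -- term 1: `4πεE(−t)ρ ≤ (η₀/4)ρ`
  have h1 : (-t) * (4 * Real.pi * ε * E) * ρ ≤ η₀ / 4 * ρ := by
    have : (-t) * (4 * Real.pi * ε * E) ≤ η₀ / 4 := by nlinarith
    exact mul_le_mul_of_nonneg_right this hρ0
  -- term 2: `2θ(−t)/(√(−t)√(−s₀)) = 2θ√(−t)/√(−s₀) ≤ 2θ = η₀/4`
  have hA : (-t) * (Real.sqrt (-t) * Real.sqrt (-s₀))⁻¹ ≤ 1 := by
    rw [← div_eq_mul_inv, div_le_one (by positivity)]
    calc (-t) = Real.sqrt (-t) * Real.sqrt (-t) := htt.symm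
      _ ≤ Real.sqrt (-t) * Real.sqrt (-s₀) := mul_le_mul_of_nonneg_left hst hsqt.le
  have h2 : (-t) * (2 * (θ * (Real.sqrt (-t) * Real.sqrt (-s₀))⁻¹)) * ρ ≤ η₀ / 4 * ρ := by
    have hθ0 : 0 ≤ θ := by rw [hθ]; positivity
    have e : (-t) * (2 * (θ * (Real.sqrt (-t) * Real.sqrt (-s₀))⁻¹)) = 2 * θ * ((-t) * (Real.sqrt (-t) * Real.sqrt (-s₀))⁻¹) := by
      ring
    rw [e]
    have : 2 * θ * ((-t) * (Real.sqrt (-t) * Real.sqrt (-s₀))⁻¹) ≤ 2 * θ := mul_le_of_le_one_right (by positivity) hA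
    have : 2 * θ * ((-t) * (Real.sqrt (-t) * Real.sqrt (-s₀))⁻¹) ≤ η₀ / 4 := by rw [hθ] at this ⊢; linarith
    exact mul_le_mul_of_nonneg_right this hρ0
  -- term 3: `2πC'·Q(−t) ≤ 2πC'√(−t) ≤ (η₀/4)R₁√(−t) ≤ (η₀/4)ρ`
  have hB : Q * (-t) ≤ Real.sqrt (-t) := by
    calc Q * (-t) = (Q * Real.sqrt (-t)) * Real.sqrt (-t) := by rw [mul_assoc, htt]
      _ ≤ 1 * Real.sqrt (-t) := mul_le_mul_of_nonneg_right hQ hsqt.le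
      _ = Real.sqrt (-t) := one_mul _
  have h3 : (-t) * (2 * Real.pi * C' * Q) ≤ η₀ / 4 * ρ := by
    have e : (-t) * (2 * Real.pi * C' * Q) = 2 * Real.pi * C' * (Q * (-t)) := by ring
    rw [e]
    calc 2 * Real.pi * C' * (Q * (-t)) ≤ 2 * Real.pi * C' * Real.sqrt (-t) := mul_le_mul_of_nonneg_left hB (by positivity)
      _ ≤ η₀ / 4 * R₁ * Real.sqrt (-t) := mul_le_mul_of_nonneg_right hR₁ hsqt.le
      _ = η₀ / 4 * (R₁ * Real.sqrt (-t)) := by ring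
      _ ≤ η₀ / 4 * ρ := mul_le_mul_of_nonneg_left hρR (by positivity)
  have e : (-t) * ((4 * Real.pi * ε * E + 2 * (θ * (Real.sqrt (-t) * Real.sqrt (-s₀))⁻¹)) * ρ + 2 * Real.pi * C' * Q) =
      (-t) * (4 * Real.pi * ε * E) * ρ + (-t) * (2 * (θ * (Real.sqrt (-t) * Real.sqrt (-s₀))⁻¹)) * ρ + (-t) * (2 * Real.pi * C' * Q) := by
    ring
  rw [e]
  nlinarith [h1, h2, h3, hη₀, hρ0]

/-- **Vertical quietness**: `(−t)·4πεE|x₂| ≤ η₀ ρ` when `|x₂| ≤ n`, `ε(1+n²) ≤ B_up`, `ε ≤ ε₀ ≤ η₀²/(16π²E₁²(−s₀)(B_up+1))`,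
`E ≤ E₁`, `s₀ ≤ t < 0` and `ρ ≥ √(−t)` (so `(−t)·4πεE|x₂| ≤ √(−s₀)·√(−t)·4πE₁ε|x₂| ≤ η₀√(−t) ≤ η₀ρ`). -/
theorem quiet_z_bound {η₀ t s₀ ε ε₀ E E₁ ρ n x₂ Bup : ℝ} (ht : t < 0) (hts₀ : s₀ ≤ t) (hη₀ : 0 < η₀) (hn : 0 ≤ n) (hx₂ : |x₂| ≤ n)
    (hε : 0 ≤ ε) (hεε₀ : ε ≤ ε₀) (hεq : ε * (1 + n ^ 2) ≤ Bup) (hBup0 : 0 ≤ Bup)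
    (hE : 0 ≤ E) (hEE₁ : E ≤ E₁) (hE₁ : 0 < E₁)
    (hε₀2 : ε₀ ≤ η₀ ^ 2 / (16 * Real.pi ^ 2 * E₁ ^ 2 * (-s₀) * (Bup + 1))) (hρσ : Real.sqrt (-t) ≤ ρ) :
    (-t) * (4 * Real.pi * ε * E * |x₂|) ≤ η₀ * ρ := by
  have hs₀ : s₀ < 0 := lt_of_le_of_lt hts₀ ht
  have hsqt : 0 < Real.sqrt (-t) := Real.sqrt_pos.2 (neg_pos.2 ht)
  have hsq₀ : 0 < Real.sqrt (-s₀) := Real.sqrt_pos.2 (neg_pos.2 hs₀)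
  have htt : Real.sqrt (-t) * Real.sqrt (-t) = -t := Real.mul_self_sqrt (neg_pos.2 ht).le
  have hst : Real.sqrt (-t) ≤ Real.sqrt (-s₀) := Real.sqrt_le_sqrt (by linarith)
  -- apply `flat_z_bound`-type reasoning with `η := η₀/√(−s₀)`
  set η : ℝ := η₀ / Real.sqrt (-s₀) with hη
  have hηpos : 0 < η := div_pos hη₀ hsq₀
  have hε₀2' : ε₀ ≤ η ^ 2 / (16 * Real.pi ^ 2 * E₁ ^ 2 * (Bup + 1)) := by
    refine hε₀2.trans (le_of_eq ?_)
    rw [hη, div_pow, Real.sq_sqrt (neg_pos.2 hs₀).le]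
    field_simp
  have h := Summit.NavierStokesRegularity.NavierStokesRegularity.Theorems.HalfSpaceWindowDoorCirculationCarryingRigidityFlatTools.touch_z_const
    hηpos hn hx₂ hε hεε₀ hεq hBup0 hE hEE₁ hE₁ hε₀2'
  -- `4πεE|x₂| ≤ η₀/√(−s₀)`; multiply by `(−t) = √(−t)√(−t) ≤ √(−s₀)·ρ`
  have h2 : (-t) ≤ Real.sqrt (-s₀) * ρ := by
    rw [← htt]; exact mul_le_mul hst hρσ hsqt.le hsq₀.le
  have h3 : 0 ≤ 4 * Real.pi * ε * E * |x₂| := by positivity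
  calc (-t) * (4 * Real.pi * ε * E * |x₂|) ≤ (Real.sqrt (-s₀) * ρ) * (4 * Real.pi * ε * E * |x₂|) :=
        mul_le_mul_of_nonneg_right h2 h3
    _ ≤ (Real.sqrt (-s₀) * ρ) * η := mul_le_mul_of_nonneg_left h (mul_nonneg hsq₀.le (hsqt.le.trans hρσ))
    _ = η₀ * ρ := by rw [hη]; field_simp

end Summit.NavierStokesRegularity.NavierStokesRegularity.Theorems.HalfSpaceWindowDoorCirculationCarryingRigidityQuietTouching

end
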